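import Mathlib
import Literature.Barriers.ValiantsHypothesis.AlgebraicNaturalProofs
import Literature.Computability.AlgebraicComplexity.ArithCircuitProofs
import HarnessLib

/-!
# Crux `BarrierLever.DefinableEquations` (stmt-ValiantsHypothesis-8745), line `registered` —
# stub `rungOne_fails_at_two`: the first rung's cube-monomial equation dies at `b = 2`

The first rung of the crux (`b ≤ 1`, circuits of size `≤ n`) rests on the structure statement
"`complexity f ≤ n` forces some variable `x_j` to have individual degree `≤ 2`", whence the
monomial equation `E_n = ∏_j c_{x_j^3}` in the coefficient variables vanishes at `coeff(f)` for
every `f ∈ SmallCircuits ℂ n b`, `b ≤ 1`.  This file records that the rung is TIGHT: already at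
`b = 2` (size `≤ n^2`) the class contains, for every `n ≥ 3`, a polynomial all of whose cube
coefficients `coeff_{x_j^3}` are nonzero, so `E_n` does not vanish on `coeff(SmallCircuits ℂ n 2)`.

Witness: the power sum `f = ∑_{i < n} x_i^3`.
* `deg f ≤ 3 ≤ n` (`totalDegree_finsetSum_le`, `totalDegree_X_pow`);
* `L(x_i^3) ≤ 2` (`x_i^3 = x_i · (x_i · x_i)`, two product gates, variables free:
  `complexity_mul_le`, `complexity_X`), so `L(f) ≤ ∑_i L(x_i^3) + n ≤ 2n + n = 3n ≤ n^2` for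
  `n ≥ 3` (`complexity_finset_sum_le`);
* `coeff_{x_j^3}(f) = ∑_i [single i 3 = single j 3] = 1 ≠ 0` (`coeff_X_pow`,
  `Finsupp.single_left_inj`).

Elementary; no new definitions, no named facts.
-/

-- single-conjunct layout: Sub = Summit, duplicated namespace component intended
set_option linter.dupNamespace false

namespace Summit.ValiantsHypothesis.ValiantsHypothesis.Theorems.BarrierLeverDefinableEquations

open MvPolynomial
open Literature.Computability.AlgebraicComplexity Literature.Barriers.ValiantsHypothesis

namespace RungOneFailsAtTwo

/-- A pure cube `x_i^3 = x_i · (x_i · x_i)` costs at most two (product) gates, variables being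
free. [folklore] -/
theorem complexity_X_pow_three_le {n : ℕ} (i : Fin n) :
    complexity ((X i : MvPolynomial (Fin n) ℂ) ^ 3) ≤ 2 := by
  have hX : complexity (X i : MvPolynomial (Fin n) ℂ) = 0 := complexity_X_holds i
  have h1 := complexity_mul_le_holds (X i : MvPolynomial (Fin n) ℂ) (X i)
  have h2 := complexity_mul_le_holds (X i : MvPolynomial (Fin n) ℂ) (X i * X i)
  rw [hX] at h1 h2
  rw [pow_three]
  omega

/-- The power sum `∑_i x_i^3` has fan-in-two complexity `≤ 3n`: two gates per cube and one
addition per summand. [folklore] -/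
theorem complexity_sum_X_pow_three_le (n : ℕ) :
    complexity (∑ i : Fin n, (X i : MvPolynomial (Fin n) ℂ) ^ 3) ≤ 3 * n := by
  refine (complexity_finset_sum_le _ _).trans ?_
  have h : ∑ i : Fin n, complexity ((X i : MvPolynomial (Fin n) ℂ) ^ 3) ≤ ∑ _i : Fin n, 2 :=
    Finset.sum_le_sum fun i _ => complexity_X_pow_three_le i
  rw [Finset.sum_const, Finset.card_univ, Fintype.card_fin, smul_eq_mul] at h
  rw [Finset.card_univ, Fintype.card_fin]
  omega

/-- The power sum `∑_i x_i^3` has total degree `≤ 3`. [folklore] -/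
theorem totalDegree_sum_X_pow_three_le (n : ℕ) :
    (∑ i : Fin n, (X i : MvPolynomial (Fin n) ℂ) ^ 3).totalDegree ≤ 3 :=
  totalDegree_finsetSum_le fun i _ => (totalDegree_X_pow (R := ℂ) i 3).le

/-- Every cube coefficient of the power sum `∑_i x_i^3` equals `1`. [folklore] -/
theorem coeff_single_three_sum_X_pow_three {n : ℕ} (j : Fin n) :
    MvPolynomial.coeff (Finsupp.single j 3) (∑ i : Fin n, (X i : MvPolynomial (Fin n) ℂ) ^ 3) = 1 := by
  classical
  rw [MvPolynomial.coeff_sum]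
  simp_rw [MvPolynomial.coeff_X_pow, Finsupp.single_left_inj (show (3 : ℕ) ≠ 0 by norm_num)]
  rw [Finset.sum_ite_eq' Finset.univ j (fun _ => (1 : ℂ)), if_pos (Finset.mem_univ j)]

end RungOneFailsAtTwo

/-- **The first rung dies at `b = 2`.** For every `n ≥ 3` the class `SmallCircuits ℂ n 2`
(degree `≤ n`, fan-in-two size `≤ n^2`) contains a polynomial — the power sum `∑_i x_i^3`, of
degree `3 ≤ n` and size `≤ 3n ≤ n^2` — whose cube coefficient `coeff_{x_j^3}` is nonzero for EVERY
variable `x_j`; hence the rung-one equation `∏_j c_{x_j^3}` does not vanish on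
`coeff(SmallCircuits ℂ n 2)`. [folklore] -/
theorem rungOne_fails_at_two : ∀ n : ℕ, 3 ≤ n → ∃ f ∈ Literature.Barriers.ValiantsHypothesis.SmallCircuits ℂ n 2, ∀ j : Fin n, MvPolynomial.coeff (Finsupp.single j 3) f ≠ 0 := by
  intro n hn
  refine ⟨∑ i : Fin n, (X i : MvPolynomial (Fin n) ℂ) ^ 3, ⟨?_, ?_⟩, fun j => ?_⟩
  · -- `deg f ≤ 3 ≤ n`
    exact (RungOneFailsAtTwo.totalDegree_sum_X_pow_three_le n).trans hn
  · -- `L(f) ≤ 3n ≤ n · n = n^2`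
    calc complexity (∑ i : Fin n, (X i : MvPolynomial (Fin n) ℂ) ^ 3)
        ≤ 3 * n := RungOneFailsAtTwo.complexity_sum_X_pow_three_le n
      _ ≤ n * n := Nat.mul_le_mul_right n hn
      _ = n ^ 2 := (sq n).symm
  · -- `coeff_{x_j^3}(f) = 1 ≠ 0`
    rw [RungOneFailsAtTwo.coeff_single_three_sum_X_pow_three j]
    exact one_ne_zero

end Summit.ValiantsHypothesis.ValiantsHypothesis.Theorems.BarrierLeverDefinableEquations
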